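import Summits.BirchSwinnertonDyer.Rank1Residual.AdditivePotMult.ClassTheorems
import Summits.BirchSwinnertonDyer.Rank1Residual.Additive.SharpenedStatements
import HarnessLib

/-!
# X3♯(M) / X4(M): BRIDGE to the additive-p4 seat's census sub-types (`Additive.SubM`) and to the
# currency of the sharpened conjecture `X3SharpM`

HONEST FRAMING (cell `b2b-bsdres`, run/shared/lean/b2b/bsd-rank1-residual/, verbatim in every
file): the goal of the cell is to DELETE the COMBINATION-SHAPED residual classes of the
Birch–Swinnerton-Dyer formula for ALL analytic-rank `≤ 1` elliptic curves over `ℚ` — "full BSD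
formula for every rank `≤ 1` curve in class `C`" assembled STRICTLY from published theorems — so
that the rank-`≤ 1` remainder becomes exactly the CONSTRUCTION-SHAPED classes, which are TYPED
(missing-input `Prop`s), NOT attempted. This is not "finishing BSD". Sub-cell
`b2b-bsdres-additive-p1`; research route, no claim beyond the stated sub-classes.

Theorems only (no new notion). Two seats typed the same census bit independently on 2026-08-19:
additive-p4's `Additive.PotMult W p := ord_p j < 0` (= its cell `SubM`, file
`Additive/SharpenedStatements.lean`, p199271) and this seat's `AdditivePotMult.PotMult W p :=
Addv W p ∧ ord_p j < 0` (`AdditivePotMult/Descent.lean`, p199906). They agree on additive pairs: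

* `potMult_iff` — `AdditivePotMult.PotMult W p ↔ Addv W p ∧ Additive.SubM W p` (definitional);
* `classX3M_iff` — `ClassX3M W p ↔ ClassX3 W p ∧ Additive.SubM W p ∧ p ≠ 2`, i.e. X3♯(M) here IS the
  hypothesis set of p4's `@[conjecture] X3SharpM` at a pair;
* `classX4M_iff` — `ClassX4M W p ↔ ClassX4 W p ∧ Additive.SubM W p`;
* `missingPPartAt_of_classX3M_of_twist` — the base-change-and-descend class theorem read in the
  currency of `X3SharpM` (`Typed.MissingPPartAt W p`): on an X3♯(M) pair, the typed over-`K` input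
  for `E_K` plus the typed X2 input for the `p`-multiplicative twist give the CONCLUSION of `X3SharpM`
  at that pair (so a proof of the relocated inputs on all data would prove `X3SharpM`; nothing is
  claimed about either).
-/

noncomputable section

open scoped Classical

open WeierstrassCurve Literature.NumberTheory.EllipticCurves
  Literature.NumberTheory.EllipticCurves.Rank1Residual
  Literature.NumberTheory.EllipticCurves.Rank1Residual.Typed
  Literature.NumberTheory.EllipticCurves.Wuthrich2014

namespace Summit.BirchSwinnertonDyer.Rank1Residual.AdditivePotMult

variable (W : WeierstrassCurve ℚ) [W.IsElliptic] [W.IsGloballyMinimal] (p : ℕ) [Fact p.Prime]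

omit [W.IsGloballyMinimal] in
/-- The two seats' "potentially multiplicative" bits agree: this seat's `PotMult` is p4's census
sub-type `SubM` (`ord_p j < 0`) together with additivity. [folklore] -/
theorem potMult_iff : PotMult W p ↔ Addv W p ∧ Additive.SubM W p := Iff.rfl

/-- X3♯(M) of this seat = class X3 ∧ p4's cell (M) ∧ `p` odd — literally the hypotheses of the
sharpened conjecture `Additive.X3SharpM` at the pair. [folklore] -/
theorem classX3M_iff : ClassX3M W p ↔ ClassX3 W p ∧ Additive.SubM W p ∧ p ≠ 2 := by
  constructor
  · rintro ⟨hX3, ⟨-, hj⟩, hp⟩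
    exact ⟨hX3, hj, hp⟩
  · rintro ⟨hX3, hj, hp⟩
    exact ⟨hX3, ⟨hX3.2, hj⟩, hp⟩

omit [W.IsGloballyMinimal] in
/-- X4(M) of this seat = class X4 ∧ p4's cell (M). [folklore] -/
theorem classX4M_iff : ClassX4M W p ↔ ClassX4 W p ∧ Additive.SubM W p := by
  constructor
  · rintro ⟨hX4, ⟨-, hj⟩⟩
    exact ⟨hX4, hj⟩
  · rintro ⟨hX4, hj⟩
    exact ⟨hX4, ⟨hX4.2.1, hj⟩⟩

/-- **The X3♯(M) class theorem in the currency of `X3SharpM`.** On an X3♯(M) pair of analytic rank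
`≤ 1`, given the twist datum of `ClassTheorems.bsdp_of_classX3M_of_twist` (quadratic `K`, a globally
minimal model `Wd` of `E^{(d_K)}` multiplicative at `p` of analytic rank `≤ 1`, a globally minimal
`K`-model `W'` of `E_K`), the typed over-`K` input and the typed X2 input of the twist yield
`Typed.MissingPPartAt W p` — the conclusion of `Additive.X3SharpM` at `(W, p)` (named facts: GZK,
modularity, Milne 1972, Wuthrich 2014 Prop. 21). [folklore] -/
theorem missingPPartAt_of_classX3M_of_twist
    (hGZK : rank_eq_analyticRank_of_analyticRank_le_one) (hmod : hasEntireLFunction_rat)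
    (hMilne : Milne1972.bsdQuotient_baseChange_quadratic) (hW : sha_dvd_analyticSha)
    (hX : ClassX3M W p) (hr : W.analyticRank ≤ 1)
    (K : Type) [Field K] [NumberField K] (h2 : Module.finrank ℚ K = 2)
    (Wd : WeierstrassCurve ℚ) [Wd.IsElliptic] [Wd.IsGloballyMinimal]
    (hWd : ∃ C : VariableChange ℚ, C • W.quadraticTwist (NumberField.discr K : ℚ) = Wd)
    (hmult : Mult Wd p) (hrd : Wd.analyticRank ≤ 1)
    (W' : WeierstrassCurve K) [W'.IsElliptic] [W'.IsGloballyMinimal]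
    (hW' : ∃ C : VariableChange K, C • W.baseChange K = W')
    (hK : MissingPPartOverAt W' p) (hX2 : X2.MissingInputAt Wd p) : MissingPPartAt W p := by
  haveI : Finite W.sha := (hGZK W hr).2
  exact missingPPartAt_of_bsdp W p
    (bsdp_of_classX3M_of_twist W p K Wd W' hGZK hmod hMilne hW hX hr h2 hWd hmult hrd hW' hK hX2)

end Summit.BirchSwinnertonDyer.Rank1Residual.AdditivePotMult

end
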